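import Summits.CriticalPhenomena.PercolationContinuityZ3.Theorems.Transplant.SkelPhiConcFaceRoute
import HarnessLib

/-!
# D″ node, (F) part 7 at φ-level (DPRIME-SCOPE §2 L6′, p3 addendum M / M.9, v2.1; hp-8 column): the CHAIN OF A PLANAR SCHEDULE ABOUT A
# WIRED SEED, TRANSFERRED — `1 − ε'' < P_{Wt}(linkIn Qt S (coreT N))`: p1-g9's schedule-generic window chain
# (`Skelφ.WinChainData.lt_real_of_chainS` at `𝒲 = planarWindowWin hlip c L`) run under the route law `Skel.routeW G Wt Qt S` with the law
# facts of part 6 (`isSubbox_routeW_schedStepD`, `schedExc_routeW`, `Skel.hsrc_routeW_of_linkIn`, `Skel.real_biUnion_openConn_routeW_le_linkIn`)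
# — schedule-generic φ-level re-cut of `SkelConcFaceRouteLink.innerRoute_link_lt` (hp-8 g25); the last conjunct of `Skelφ.kitClause'`'s
# `hcon'` for a DEEP face-step contact (`∃ Qt Ft, Ft ⊆ T ∧ Qt ⊆ D ∧ Disjoint Ft (Λc c n) ∧ 1 − δ² < P_{Wt}(linkIn Qt (Λc c kz) Ft)`) is this
# with `Qt := schedQt …`, `Ft := coreT N` (the far face, inside the target span by `innerSched_coreT_subset_M`)

builds on p205010 (kernel theorem, internal audit signed; external expert review pending) — nothing in this file uses p205010.
Lane `prim-bschramm`, seat `prim-hp-8` (gen 30; L6′ (F) owner); helper file (`--supports stmt-CriticalPhenomena-4575`).  Hypotheses through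
p3-g7's dictionary: `hlip : Skelφ.Lip G φ`; data as in part 6 plus the non-planar chain data (`Rlev N j₀ j₁`, rim depth `L'`), the chain
property `hchain` of length `Sch.N + 1` at `(δ ↦ ε'')` (a `∀ n` family at the closure — no constants cycle, lead 05:51:21Z (II)), the kits of
every step as ABSTRACT `KitsAt` facts (`hKits`; supplied per level by p1-g9's `kitsAt_stepA_win′` from the Step-I′ certificate), nonempty true
targets, and the first hop (`U ⊆ Qt ∩ Rg` the first rectangle's prism, sub-seed `S₀ ⊆ S ⊆ U`, landing set `T₀` inside the window over core `0`,
the `P_p^G`-link `1 − δ < P(linkIn U S₀ T₀)` = `Skelφ.link_at_center`).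
* `schedChain G φ c L L' F Sch o Rlev N j₀ j₁ : WinChainData V` (source `o`, support `schedQt`, rim parts `schedRim`) + `rfl` readings;
* **`link_lt_of_schedChain (hlip)`**.
[cite: KozmaNitzan2024, §4 Lemma 11 (pp. 22–23), Lemma 12 (pp. 23–25), p. 20 (Step IV), p. 30 (Step III)]
-/

noncomputable section

open MeasureTheory ProbabilityTheory
open scoped ENNReal Classical

namespace Summit.CriticalPhenomena.PercolationContinuityZ3.Theorems.Transplant

namespace Skelφ

open Literature.Probability.Percolation Literature.Probability.LatticeModels SimpleGraph
open Literature.Probability.Percolation.KozmaNitzan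
open Literature.Barriers.CriticalPhenomena (graphBall graphBall_finite mem_graphBall_self graphBall_mono)
open KNLevels ChainPlanar
open Skel (winGraph routeW excess)

variable {V : Type} [DecidableEq V] [Countable V] (G : SimpleGraph V) [G.LocallyFinite] (φ : V → Site 2)

/-- **The window-chain data of a schedule about a wired source**: level depth `Rlev`, contact count `N`, level window `[j₀, j₁]`, source
`o`, support the route world `schedQt`, rim parts `schedRim` (the region-`k` vertices beyond depth `L − L'`).
[cite: KozmaNitzan2024, §4 Lemma 10 (p. 17), Lemma 12 (pp. 23–25)] -/
def schedChain (c : V) (L L' : ℕ) (F : Finset (Site 2)) (Sch : Schedule) (o : V) (Rlev N j₀ j₁ : ℕ) : WinChainData V :=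
  ⟨Rlev, N, j₀, j₁, o, schedQt G φ c L F Sch, schedRim G φ c L L' Sch⟩

variable {G φ}

section Readings

variable (c : V) (L L' : ℕ) (F : Finset (Site 2)) (Sch : Schedule) (o : V) (Rlev N j₀ j₁ : ℕ)

omit [DecidableEq V] [Countable V] in
/-- The source. [folklore] -/
@[simp] theorem schedChain_o : (schedChain G φ c L L' F Sch o Rlev N j₀ j₁).o = o := rfl

omit [DecidableEq V] [Countable V] in
/-- The support. [folklore] -/
@[simp] theorem schedChain_Sfin : (schedChain G φ c L L' F Sch o Rlev N j₀ j₁).Sfin = schedQt G φ c L F Sch := rfl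

omit [DecidableEq V] [Countable V] in
/-- The rim parts. [folklore] -/
@[simp] theorem schedChain_Rim (k : ℕ) : (schedChain G φ c L L' F Sch o Rlev N j₀ j₁).Rim k = schedRim G φ c L L' Sch k := rfl

omit [DecidableEq V] [Countable V] in
/-- The numeric data. [folklore] -/
theorem schedChain_params : (schedChain G φ c L L' F Sch o Rlev N j₀ j₁).Rlev = Rlev ∧ (schedChain G φ c L L' F Sch o Rlev N j₀ j₁).N = N ∧
    (schedChain G φ c L L' F Sch o Rlev N j₀ j₁).j₀ = j₀ ∧ (schedChain G φ c L L' F Sch o Rlev N j₀ j₁).j₁ = j₁ := ⟨rfl, rfl, rfl, rfl⟩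

end Readings

/-- **THE CHAIN ABOUT A WIRED SEED, TRANSFERRED TO THE LINK EVENT UNDER `Wt`**: for a planar schedule `Sch` read through the plain window
about `c` of depth `L`, the route law `routeW Wt Qt S` (`Wt` a subbox weighting of `winGraph G w₀ R` on `Rg ⊇ Qt`, vanishing off `G`; the
seed `S ∋ o` wired, inside `Qt`, internally connected, within `R₀'` of `c`, missing every region window), a planar set `Pl ⊇ F, regions`
of diameter `m`, a centre-uniform excess radius `R₁ ≤ L − L'`, the chain data with `Rlev + 1 ≤ R'`, `j₁ ≤ Rlev`, the count inequality, the
chain property of length `Sch.N + 1`, abstract kits of every step, nonempty true targets, and the first hop (a `P_p^G`-link inside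
`U ⊆ Qt ∩ Rg`, `S ⊆ U`, from `S₀ ⊆ S` to `T₀` inside the window over core `0`): `1 − ε'' < P_{Wt}(linkIn Qt S (coreT N))`.
[cite: KozmaNitzan2024, §4 Lemma 11 (pp. 22–23), Lemma 12 (pp. 23–25), p. 20 (Step IV)] -/
theorem link_lt_of_schedChain (hlip : Lip G φ) {w₀ c : V} {R L : ℕ} {Wt : Sym2 V → unitInterval} {p : unitInterval} {Rg S : Finset V}
    {F : Finset (Site 2)} {Sch : Schedule} (hWG : ∀ e, e ∉ G.edgeSet → Wt e = 0) (hWD : IsSubbox (winGraph G w₀ R) Wt p Rg)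
    (hRg : ∀ u ∈ Rg, u ∈ graphBall G w₀ R) (hQ : schedQt G φ c L F Sch ⊆ Rg) {Pl : Finset (Site 2)} {m : ℕ} (hF : F ⊆ Pl)
    (hPlS : ∀ k ≤ Sch.N, Sch.region k ⊆ Pl) (hPl : ∀ y ∈ Pl, ∀ y' ∈ Pl, y - y' ∈ box 2 m) (hSQ : S ⊆ schedQt G φ c L F Sch)
    {o : V} (ho : o ∈ S) (hconn : ∀ s ∈ S, PathIn G (↑S : Set V) o s) {R₀' : ℕ} (hnear : ∀ s ∈ S, s ∈ graphBall G c R₀')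
    (hSD : ∀ k ≤ Sch.N, Disjoint S ((planarWindowWin hlip c L).stepD Sch k)) {η : ℝ} {R₁ L' : ℕ}
    (hR₁ : ∀ (c' : V) (R'' : ℕ), R₁ ≤ R'' → ∀ (Rw : ℕ) (D' A' : Finset V), (∀ d ∈ D', d ∈ graphBall G c' Rw) →
      (∀ d ∈ D', ∀ d' ∈ D', φ d - φ d' ∈ box 2 m) → A' ⊆ D' → (∀ a ∈ A', a ∈ graphBall G c' R₀') →
        (bondPercolation G p).real (excess G c' R'' D' A') ≤ η)
    (hR : R₁ ≤ L - L')
    -- the chain data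
    {Rlev N j₀ j₁ : ℕ} (hRl : Rlev + 1 ≤ Sch.R') (hj : j₁ ≤ Rlev) {Δ' : ℕ} {δ ε'' : ℝ} (hη : η ≤ δ / 2)
    (hcount : 1 / (1 - (p : ℝ)) ^ (Δ' * N) ≤ δ * ((Finset.Icc j₀ j₁).card : ℝ))
    (hchain : ∀ (Wg : Sym2 V → unitInterval) (s : Fin (Sch.N + 1) → TStep (winGraph G c L))
      (T' : Fin (Sch.N + 1) → Finset V) (η : ℝ),
      (∀ i, (s i).L.o = (s 0).L.o) →
      (∀ i : Fin Sch.N, T' (Fin.castSucc i) ⊆ (s i.succ).L.X 0) →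
      (∀ i, T' i ⊆ (s i).T) →
      (∀ i, (s i).KitsAt Wg p Δ' δ) →
      η ≤ δ / 2 →
      (∀ i, (prodBernoulli Wg).real (⋃ t ∈ (s i).T \ T' i, openConn (s 0).L.o t) ≤ η) →
      1 - δ < (prodBernoulli Wg).real (s 0).L.reachB →
        1 - ε'' < (prodBernoulli Wg).real (⋃ t ∈ T' (Fin.last Sch.N), openConn (s 0).L.o t))
    (hTne : ∀ k ≤ Sch.N, ((planarWindowWin hlip c L).coreT Sch k).Nonempty)
    (hKits : ∀ k ≤ Sch.N, ((schedChain G φ c L L' F Sch o Rlev N j₀ j₁).stepA (planarWindowWin hlip c L) Sch k).KitsAt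
      (routeW G Wt (schedQt G φ c L F Sch) S) p Δ' δ)
    -- the first hop
    {U S₀ T₀ : Finset V} (hUQ : U ⊆ schedQt G φ c L F Sch) (hUR : U ⊆ Rg) (hS₀ : S₀ ⊆ S) (hSU : S ⊆ U)
    (hT₀ : T₀ ⊆ Win G φ c (Sch.core 0) L) (hlink : 1 - δ < (bondPercolation G p).real (linkIn (↑U : Set V) S₀ T₀)) :
    1 - ε'' < (prodBernoulli Wt).real
      (linkIn (↑(schedQt G φ c L F Sch) : Set V) S ((planarWindowWin hlip c L).coreT Sch Sch.N)) := by
  refine (schedChain G φ c L L' F Sch o Rlev N j₀ j₁).lt_real_of_chainS (planarWindowWin hlip c L) Sch hRl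
    (fun k => schedRim_subset_stepD hlip c L L' Sch k) hTne hchain
    (fun k hk => isSubbox_routeW_schedStepD hlip hWG hWD hRg hQ hk (hSD k hk)) (Skel.finSupp_routeW G Wt _ S)
    (fun k hk => stepD_subset_schedQt hlip F hk) (fun k hk hok => Finset.disjoint_left.1 (hSD k hk) ho hok) (hSQ ho) hj hcount
    (fun k hk => (hKits k hk).2.2.2.2.2) hη
    (fun k hk => schedExc_routeW hlip hWD hRg hQ hF hPlS hPl hSQ ho hnear hR₁ hR hk (hSD k hk))
    (B₀ := Win G φ c (Sch.core 0) L) (by rw [WinChainData.stepL_X_zero]; exact subset_rfl)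
    (Skel.hsrc_routeW_of_linkIn hWD hRg hUQ hUR hSQ hS₀ hSU hconn hT₀ hlink) subset_rfl
    (Skel.real_biUnion_openConn_routeW_le_linkIn G Wt hSQ
      ((hSD Sch.N le_rfl).mono_right ((planarWindowWin hlip c L).coreT_subset_stepD Sch le_rfl)) ho)

end Skelφ

end Summit.CriticalPhenomena.PercolationContinuityZ3.Theorems.Transplant

end
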